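import Summits.HubbardSuperconductivity.HubbardSuperconductivity.Theses.SeamInduction

/-!
# Vocabulary of the Hubbard tubes `ℤ/L × ℤ/M` shared by the cruxes of routes `WidthHaldane` and
# `SeamInduction`

Routes `WidthHaldane` (items stmt-HubbardSuperconductivity-16310 `TubeFamilyLaw`, 16311
`WidthHaldaneBridge`, 16312 `WidthUniformThermodynamics`) and `SeamInduction` (the same 16311/16312
plus 18509 `SeamGluingLocality`, 18510 `PerWidthThermodynamics`) state ALL their items over one and
the same `let`-prefix (≈ 3 kB per item): the pure Hubbard tube on an arbitrary linearly ordered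
carrier `e : Λ ≃ ℤ/L × ℤ/M`, its seam twist, the twisted sector energies, the filling, the twist
stiffness per site, the inverse pair compressibility, the column `d_{x²-y²}` pair field and its
correlation. This file only NAMES these objects — every definition below is the corresponding
`let`-body, character for character, with the `let`-bound names replaced by the new constants — and
certifies by `Iff.rfl` that the four open items ARE the displayed short statements over the names
(`widthHaldaneBridge_iff`, `widthUniformThermodynamics_iff`, `seamGluingLocality_iff`,
`perWidthThermodynamics_iff`). The two slices `UniformThermo` (the hypothesis of the Bridge = the
matrix of `WidthUniformThermodynamics`) and `HaldaneLawAt` (the conclusion of the Bridge at ONE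
width) are the predicates the registered skeleton `Cruxes/WidthHaldaneBridge/Lines/birth.lean` calls
`UniformThermo` / `LawAt`; `haldaneLaw_iff_forall_haldaneLawAt` is the binder shuffle between the
crux's conclusion and its per-width slices.

* `tubeGraph e` — nearest-neighbour graph of `ℤ/L × ℤ/M` pulled back along `e`
  (steps `(a,b) ↦ (a+1,b)`, `(a,b) ↦ (a,b+1)`, symmetrised by `SimpleGraph.fromRel`);
* `tubeH0 L M Λ e U = hamiltonian (tubeGraph e) 1 U` — the pure Hubbard tube, `t = 1`;
* `tubeTwist L M Λ e θ` — the seam Peierls correction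
  `Σ_{b,σ} (1 - e^{iθ}) c†_{(0,b)σ} c_{(-1,b)σ} + (1 - e^{-iθ}) c†_{(-1,b)σ} c_{(0,b)σ}` (added to
  `tubeH0` it turns the seam hoppings `-1` into `-e^{± iθ}`: flux `θ` through the long cycle, exactly
  as `Literature…hubbardTorusFlux` does on the square torus);
* `tubeEnergy L M Λ e U θ N` — lowest energy of `tubeH0 + tubeTwist θ` in the sector `(N, S^z = 0)`;
* `tubeFilling L M δ = 2⌊(1-δ)LM/2⌋`;
* `tubeStiffness L M Λ e U δ = 2L[E(π/3) - E(0)]/((π/3)² M)` (twist stiffness per site `ρ̃_{L,M}`);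
* `tubePairCompressibility L M Λ e U δ = LM[E(N+2) + E(N-2) - 2E(N)]/4` (inverse pair
  compressibility `ẽ″_{L,M}`);
* `tubeDWavePair L M Λ e x` — the `d_{x²-y²}` singlet pair annihilator centred at `x`;
  `tubeColumnPairCorr L M Λ e ψ r = G_ψ(r)` — the column pair correlation at long-cycle displacement `r`;
* `UniformThermo`, `HaldaneLaw`, `HaldaneLawAt` — the hypothesis / conclusion / per-width conclusion
  of `WidthHaldaneBridge`.

Nothing is proved here except `Iff.rfl`/`rfl` faithfulness checks and one binder shuffle. The
`open scoped Classical` below is deliberate: the route files elaborate `hamiltonian (fromRel …)` with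
the classical `DecidableRel` instance, and the faithfulness lemmas are definitional only if the same
instance is used here.

Sources for the objects (not for any claim): Byers–Yang, PRL 7 (1961) 46 and Scalapino–White–Zhang,
PRB 47 (1993) 7995 (flux through a cycle, superfluid stiffness from the sector-minimum envelope);
Scalapino, Phys. Rep. 250 (1995) 329, §2 (the `d_{x²-y²}` pair field); Haldane, PRL 47 (1981) 1840
(Luttinger-liquid relations, the form of the law).
-/

noncomputable section

namespace Summit.HubbardSuperconductivity.HubbardSuperconductivity.Theorems.WidthHaldane

set_option linter.dupNamespace false -- summit = problem name (single-conjunct summit), D-0017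

open scoped BigOperators Classical Matrix ComplexConjugate
open Matrix Literature.MathematicalPhysics.QuantumLattice
open Summit.HubbardSuperconductivity.HubbardSuperconductivity.Theses.WidthHaldane
  (WidthHaldaneBridge WidthUniformThermodynamics)
open Summit.HubbardSuperconductivity.HubbardSuperconductivity.Theses.SeamInduction
  (SeamGluingLocality PerWidthThermodynamics)

/-! ### The tube, its seam twist and its sector energies -/

/-- The nearest-neighbour graph of the tube `ℤ/L × ℤ/M` pulled back to the carrier `Λ` along the
labelling `e` (the relation "`y` is the `+e₁`- or `+e₂`-neighbour of `x`", symmetrised and made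
irreflexive by `SimpleGraph.fromRel`) — the graph argument of the cruxes' `let H0`; reducible, so
that instance search sees the `fromRel` adjacency through it. [folklore] -/
abbrev tubeGraph {L M : ℕ} {Λ : Type} (e : Λ ≃ ZMod L × ZMod M) : SimpleGraph Λ :=
  SimpleGraph.fromRel fun x y : Λ => y = e.symm ((e x).1 + 1, (e x).2) ∨ y = e.symm ((e x).1, (e x).2 + 1)

/-- The pure Hubbard tube `H₀ = -Σ_{⟨xy⟩,σ} c†_{xσ}c_{yσ} + U Σ_x n_{x↑}n_{x↓}` (`t = 1`, `t' = 0`) on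
the labelled carrier — verbatim the cruxes' `let H0`. [folklore] -/
def tubeH0 (L M : ℕ) (Λ : Type) [LinearOrder Λ] [Fintype Λ] (e : Λ ≃ ZMod L × ZMod M) (U : ℝ) :
    Matrix (Finset (Orb Λ)) (Finset (Orb Λ)) ℂ :=
  hamiltonian (SimpleGraph.fromRel fun x y : Λ => y = e.symm ((e x).1 + 1, (e x).2) ∨ y = e.symm ((e x).1, (e x).2 + 1)) 1 U

/-- The seam twist `Σ_{b,σ} (1 - e^{iθ}) c†_{(0,b)σ} c_{(-1,b)σ} + (1 - e^{-iθ}) c†_{(-1,b)σ} c_{(0,b)σ}`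
(Peierls phase `e^{± iθ}` on the `M` bonds between the columns of long coordinate `-1` and `0`) —
verbatim the cruxes' `let Tw`. [cite: Watanabe2019, §2.2.3 and §4.1] -/
def tubeTwist (L M : ℕ) [NeZero L] [NeZero M] (Λ : Type) [LinearOrder Λ] [Fintype Λ]
    (e : Λ ≃ ZMod L × ZMod M) (θ : ℝ) : Matrix (Finset (Orb Λ)) (Finset (Orb Λ)) ℂ :=
  ∑ b : ZMod M, ∑ σ : Fin 2, ((1 - Complex.exp (Complex.I * θ)) • (creation (orb (e.symm (0, b)) σ) * annihilation (orb (e.symm (-1, b)) σ)) + (1 - Complex.exp (-(Complex.I * θ))) • (creation (orb (e.symm (-1, b)) σ) * annihilation (orb (e.symm (0, b)) σ)))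

/-- The twisted sector energy `E_{L,M}(U; θ, N)`: the lowest energy of `tubeH0 + tubeTwist θ` in the
joint sector `(N, S^z = 0)` (`Matrix.minEnergyOn`, `szSector`) — verbatim the cruxes' `let E`.
[cite: ScalapinoWhiteZhang1993, §II] -/
def tubeEnergy (L M : ℕ) [NeZero L] [NeZero M] (Λ : Type) [LinearOrder Λ] [Fintype Λ]
    (e : Λ ≃ ZMod L × ZMod M) (U θ : ℝ) (N : ℕ) : ℝ :=
  (tubeH0 L M Λ e U + tubeTwist L M Λ e θ).minEnergyOn (szSector N 0)

/-- The filling `N_{L,M}(δ) = 2⌊(1-δ)LM/2⌋` (even, hole doping `→ δ`) — verbatim the cruxes'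
`let Np`. [folklore] -/
def tubeFilling (L M : ℕ) (δ : ℝ) : ℕ :=
  2 * ⌊(1 - δ) * ((L : ℝ) * (M : ℝ)) / 2⌋₊

/-- The twist stiffness per site `ρ̃_{L,M}(U,δ) = 2L[E(π/3) - E(0)]/((π/3)² M)` at the fixed twist
`θ₀ = π/3` — verbatim the cruxes' `let stiff`. [cite: ScalapinoWhiteZhang1993, §II] -/
def tubeStiffness (L M : ℕ) [NeZero L] [NeZero M] (Λ : Type) [LinearOrder Λ] [Fintype Λ]
    (e : Λ ≃ ZMod L × ZMod M) (U δ : ℝ) : ℝ :=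
  2 * (L : ℝ) * (tubeEnergy L M Λ e U (Real.pi / 3) (tubeFilling L M δ) - tubeEnergy L M Λ e U 0 (tubeFilling L M δ)) / ((Real.pi / 3) ^ 2 * (M : ℝ))

/-- The inverse pair compressibility `ẽ″_{L,M}(U,δ) = LM[E(N+2) + E(N-2) - 2E(N)]/4` at zero twist —
verbatim the cruxes' `let icomp`. [folklore] -/
def tubePairCompressibility (L M : ℕ) [NeZero L] [NeZero M] (Λ : Type) [LinearOrder Λ] [Fintype Λ]
    (e : Λ ≃ ZMod L × ZMod M) (U δ : ℝ) : ℝ :=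
  (L : ℝ) * (M : ℝ) * (tubeEnergy L M Λ e U 0 (tubeFilling L M δ + 2) + tubeEnergy L M Λ e U 0 (tubeFilling L M δ - 2) - 2 * tubeEnergy L M Λ e U 0 (tubeFilling L M δ)) / 4

/-! ### The column `d_{x²-y²}` pair field -/

/-- The `d_{x²-y²}` singlet pair annihilator centred at `x`:
`P_x = Σ_j (w_j/√2) (c_{x↑} c_{n_j↓} - c_{x↓} c_{n_j↑})`, neighbours `n = (x+e₁, x-e₁, x+e₂, x-e₂)`,
weights `w = (1, 1, -1, -1)` — verbatim the cruxes' `let P`. [cite: Scalapino1995, §2 eq. (2.4)] -/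
def tubeDWavePair (L M : ℕ) (Λ : Type) [LinearOrder Λ] [Fintype Λ] (e : Λ ≃ ZMod L × ZMod M)
    (x : Λ) : Matrix (Finset (Orb Λ)) (Finset (Orb Λ)) ℂ :=
  ∑ j : Fin 4, (((![1, 1, -1, -1] : Fin 4 → ℝ) j / Real.sqrt 2 : ℝ) : ℂ) • (annihilation (orb x 0) * annihilation (orb ((![e.symm ((e x).1 + 1, (e x).2), e.symm ((e x).1 - 1, (e x).2), e.symm ((e x).1, (e x).2 + 1), e.symm ((e x).1, (e x).2 - 1)] : Fin 4 → Λ) j) 1) - annihilation (orb x 1) * annihilation (orb ((![e.symm ((e x).1 + 1, (e x).2), e.symm ((e x).1 - 1, (e x).2), e.symm ((e x).1, (e x).2 + 1), e.symm ((e x).1, (e x).2 - 1)] : Fin 4 → Λ) j) 0))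

/-- The column pair correlation `G_ψ(r) = Σ_a Re⟨ψ, Φ_a† Φ_{a+r} ψ⟩`, `Φ_a = Σ_b P_{e⁻¹(a,b)}` the
column pair field — verbatim the cruxes' `let G`. [cite: Scalapino1995, §2 eq. (2.4)] -/
def tubeColumnPairCorr (L M : ℕ) [NeZero L] [NeZero M] (Λ : Type) [LinearOrder Λ] [Fintype Λ]
    (e : Λ ≃ ZMod L × ZMod M) (ψ : Fock (Orb Λ)) (r : ZMod L) : ℝ :=
  ∑ a : ZMod L, (expect ((∑ b : ZMod M, tubeDWavePair L M Λ e (e.symm (a, b)))ᴴ * (∑ b : ZMod M, tubeDWavePair L M Λ e (e.symm (a + r, b)))) ψ).re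

/-! ### The hypothesis and the conclusion of the Bridge -/

/-- WIDTH-UNIFORM THERMODYNAMICS with data `(d₀, k₀, M₁, L₀)` at `(U, δ)`: `d₀ ≤ ρ̃_{L,M}` and
`0 < ẽ″_{L,M} ≤ k₀` for all even `L ≥ L₀`, all even widths `M₁ ≤ M ≤ L`, every labelling — the
hypothesis of `WidthHaldaneBridge` and the matrix of `WidthUniformThermodynamics` (the skeleton's
`UniformThermo`). [folklore] -/
def UniformThermo (U δ d₀ k₀ : ℝ) (M₁ L₀ : ℕ) : Prop :=
  ∀ (L M : ℕ) [NeZero L] [NeZero M], Even L → Even M → M₁ ≤ M → M ≤ L → L₀ ≤ L → ∀ (Λ : Type) [LinearOrder Λ] [Fintype Λ] (e : Λ ≃ ZMod L × ZMod M), d₀ ≤ tubeStiffness L M Λ e U δ ∧ 0 < tubePairCompressibility L M Λ e U δ ∧ tubePairCompressibility L M Λ e U δ ≤ k₀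

/-- THE HALDANE-FORM LAW with constants `(Ξ, A, R, M₂, L₁)` at `(U, δ)`: for all even `L ≥ L₁`, all
even widths `M₂ ≤ M ≤ L`, every labelling, every normalised `(N_{L,M}, S^z = 0)` sector ground state
`ψ` of the untwisted tube and every `r` with `R ≤ r̂ = min(r, L-r)`:
`A·L·M²·r̂^{-Ξ√(ẽ″/ρ̃)/M} ≤ G_ψ(r)` — the conclusion of `WidthHaldaneBridge`, same binder order.
[cite: Haldane1981, eqs. (4)–(7)] -/
def HaldaneLaw (U δ Ξ A : ℝ) (R M₂ L₁ : ℕ) : Prop :=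
  ∀ (L M : ℕ) [NeZero L] [NeZero M], Even L → Even M → M₂ ≤ M → M ≤ L → L₁ ≤ L → ∀ (Λ : Type) [LinearOrder Λ] [Fintype Λ] (e : Λ ≃ ZMod L × ZMod M), ∀ ψ : Fock (Orb Λ), star ψ ⬝ᵥ ψ = 1 → IsGroundStateInSector (tubeH0 L M Λ e U) (tubeFilling L M δ) 0 ψ → ∀ r : ZMod L, R ≤ r.val → r.val + R ≤ L → A * (L : ℝ) * (M : ℝ) ^ 2 * ((min r.val (L - r.val) : ℕ) : ℝ) ^ (-(Ξ * Real.sqrt (tubePairCompressibility L M Λ e U δ / tubeStiffness L M Λ e U δ) / (M : ℝ))) ≤ tubeColumnPairCorr L M Λ e ψ r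

/-- The Haldane-form law AT ONE WIDTH `M` with constants `(Ξ, A, R, L₁)` (the skeleton's `LawAt`):
the matrix of `HaldaneLaw` with the width fixed. [cite: Haldane1981, eqs. (4)–(7)] -/
def HaldaneLawAt (U δ : ℝ) (M : ℕ) (Ξ A : ℝ) (R L₁ : ℕ) : Prop :=
  ∀ (L : ℕ) [NeZero L] [NeZero M], Even L → M ≤ L → L₁ ≤ L → ∀ (Λ : Type) [LinearOrder Λ] [Fintype Λ] (e : Λ ≃ ZMod L × ZMod M), ∀ ψ : Fock (Orb Λ), star ψ ⬝ᵥ ψ = 1 → IsGroundStateInSector (tubeH0 L M Λ e U) (tubeFilling L M δ) 0 ψ → ∀ r : ZMod L, R ≤ r.val → r.val + R ≤ L → A * (L : ℝ) * (M : ℝ) ^ 2 * ((min r.val (L - r.val) : ℕ) : ℝ) ^ (-(Ξ * Real.sqrt (tubePairCompressibility L M Λ e U δ / tubeStiffness L M Λ e U δ) / (M : ℝ))) ≤ tubeColumnPairCorr L M Λ e ψ r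

/-! ### Unfolding lemmas -/

/-- `tubeH0` is the Hubbard Hamiltonian of `tubeGraph e` at `t = 1` (definitional). [folklore] -/
theorem tubeH0_eq (L M : ℕ) (Λ : Type) [LinearOrder Λ] [Fintype Λ] (e : Λ ≃ ZMod L × ZMod M)
    (U : ℝ) : tubeH0 L M Λ e U = hamiltonian (tubeGraph e) 1 U := rfl

/-- `tubeEnergy` unfolded (definitional). [folklore] -/
theorem tubeEnergy_eq (L M : ℕ) [NeZero L] [NeZero M] (Λ : Type) [LinearOrder Λ] [Fintype Λ]
    (e : Λ ≃ ZMod L × ZMod M) (U θ : ℝ) (N : ℕ) :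
    tubeEnergy L M Λ e U θ N = (tubeH0 L M Λ e U + tubeTwist L M Λ e θ).minEnergyOn (szSector N 0) :=
  rfl

/-- `tubeStiffness` unfolded (definitional). [folklore] -/
theorem tubeStiffness_eq (L M : ℕ) [NeZero L] [NeZero M] (Λ : Type) [LinearOrder Λ] [Fintype Λ]
    (e : Λ ≃ ZMod L × ZMod M) (U δ : ℝ) :
    tubeStiffness L M Λ e U δ = 2 * (L : ℝ) *
      (tubeEnergy L M Λ e U (Real.pi / 3) (tubeFilling L M δ) -
        tubeEnergy L M Λ e U 0 (tubeFilling L M δ)) / ((Real.pi / 3) ^ 2 * (M : ℝ)) := rfl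

/-- `tubePairCompressibility` unfolded (definitional). [folklore] -/
theorem tubePairCompressibility_eq (L M : ℕ) [NeZero L] [NeZero M] (Λ : Type) [LinearOrder Λ]
    [Fintype Λ] (e : Λ ≃ ZMod L × ZMod M) (U δ : ℝ) :
    tubePairCompressibility L M Λ e U δ = (L : ℝ) * (M : ℝ) *
      (tubeEnergy L M Λ e U 0 (tubeFilling L M δ + 2) + tubeEnergy L M Λ e U 0 (tubeFilling L M δ - 2) -
        2 * tubeEnergy L M Λ e U 0 (tubeFilling L M δ)) / 4 := rfl

/-- The law is the conjunction of its per-width slices (binder shuffle only). [folklore] -/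
theorem haldaneLaw_iff_forall_haldaneLawAt (U δ Ξ A : ℝ) (R M₂ L₁ : ℕ) :
    HaldaneLaw U δ Ξ A R M₂ L₁ ↔ ∀ M : ℕ, Even M → M₂ ≤ M → HaldaneLawAt U δ M Ξ A R L₁ := by
  constructor
  · intro h M hMe hM L _ _ hLe hML hL Λ _ _ e ψ hψ hGS r hr hrL
    exact h L M hLe hMe hM hML hL Λ e ψ hψ hGS r hr hrL
  · intro h L M _ _ hLe hMe hM hML hL Λ _ _ e ψ hψ hGS r hr hrL
    exact h M hMe hM L hLe hML hL Λ e ψ hψ hGS r hr hrL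

/-! ### Faithfulness: the four open items over the names -/

/-- **`WidthHaldaneBridge` (stmt-HubbardSuperconductivity-16311) over the names**: for every `U > 0`,
`δ ∈ (0, 3/10)` and data, `UniformThermo → ∃ Ξ > 0, A > 0, R, M₂, L₁, HaldaneLaw` — by `Iff.rfl`
(the two sides are `δζ`-convertible). [folklore] -/
theorem widthHaldaneBridge_iff :
    WidthHaldaneBridge ↔
      ∀ U : ℝ, 0 < U → ∀ δ ∈ Set.Ioo (0 : ℝ) (3 / 10), ∀ (d₀ k₀ : ℝ) (M₁ L₀ : ℕ), 0 < d₀ →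
        UniformThermo U δ d₀ k₀ M₁ L₀ →
          ∃ Ξ : ℝ, 0 < Ξ ∧ ∃ A : ℝ, 0 < A ∧ ∃ R M₂ L₁ : ℕ, HaldaneLaw U δ Ξ A R M₂ L₁ :=
  Iff.rfl

/-- The `SeamInduction` copy of the Bridge is the `WidthHaldane` decl (same text). [folklore] -/
theorem seamInduction_widthHaldaneBridge_iff :
    Summit.HubbardSuperconductivity.HubbardSuperconductivity.Theses.SeamInduction.WidthHaldaneBridge ↔
      WidthHaldaneBridge :=
  Iff.rfl

/-- **`WidthUniformThermodynamics` (stmt-HubbardSuperconductivity-16312) over the names**: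
`∃ U > 0, δ ∈ (0, 3/10), d₀ > 0, k₀, M₁, L₀, UniformThermo U δ d₀ k₀ M₁ L₀`. [folklore] -/
theorem widthUniformThermodynamics_iff :
    WidthUniformThermodynamics ↔
      ∃ U : ℝ, 0 < U ∧ ∃ δ ∈ Set.Ioo (0 : ℝ) (3 / 10), ∃ d₀ : ℝ, 0 < d₀ ∧ ∃ k₀ : ℝ, ∃ M₁ L₀ : ℕ,
        UniformThermo U δ d₀ k₀ M₁ L₀ :=
  Iff.rfl

/-- The `SeamInduction` copy of `WidthUniformThermodynamics` is the `WidthHaldane` decl. [folklore] -/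
theorem seamInduction_widthUniformThermodynamics_iff :
    Summit.HubbardSuperconductivity.HubbardSuperconductivity.Theses.SeamInduction.WidthUniformThermodynamics ↔
      WidthUniformThermodynamics :=
  Iff.rfl

/-- **`PerWidthThermodynamics` (stmt-HubbardSuperconductivity-18510) over the names**: at some
`(U, δ)`, every even width `M ≥ 2` separately has `d_M ≤ ρ̃_{L,M}` and `0 < ẽ″_{L,M} ≤ k_M` for all
even `L ≥ max(M, L_M)`, every labelling. [folklore] -/
theorem perWidthThermodynamics_iff :
    PerWidthThermodynamics ↔
      ∃ U : ℝ, 0 < U ∧ ∃ δ ∈ Set.Ioo (0 : ℝ) (3 / 10), ∀ (M : ℕ) [NeZero M], Even M → 2 ≤ M →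
        ∃ d : ℝ, 0 < d ∧ ∃ k : ℝ, ∃ L₁ : ℕ, ∀ (L : ℕ) [NeZero L], Even L → M ≤ L → L₁ ≤ L →
          ∀ (Λ : Type) [LinearOrder Λ] [Fintype Λ] (e : Λ ≃ ZMod L × ZMod M),
            d ≤ tubeStiffness L M Λ e U δ ∧ 0 < tubePairCompressibility L M Λ e U δ ∧
              tubePairCompressibility L M Λ e U δ ≤ k :=
  Iff.rfl

/-- **`SeamGluingLocality` (stmt-HubbardSuperconductivity-18509) over the names**: for every `U > 0`,
`δ ∈ (0, 3/10)` there are `M₂, L₂` such that gluing two even tubes of widths `M', M'' ≥ M₂` into one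
of width `M = M' + M'' ≤ L` (`L ≥ L₂` even; any labellings of the three tubes) changes the two
responses by at most the boundary factors `1 ∓ M₂/M` on the positive parts. [folklore] -/
theorem seamGluingLocality_iff :
    SeamGluingLocality ↔
      ∀ U : ℝ, 0 < U → ∀ δ ∈ Set.Ioo (0 : ℝ) (3 / 10), ∃ M₂ L₂ : ℕ,
        ∀ (L M' M'' M : ℕ) [NeZero L] [NeZero M'] [NeZero M''] [NeZero M], Even L → Even M' →
          Even M'' → M₂ ≤ M' → M₂ ≤ M'' → M' + M'' = M → M ≤ L → L₂ ≤ L →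
            ∀ (Λ' : Type) [LinearOrder Λ'] [Fintype Λ'] (e' : Λ' ≃ ZMod L × ZMod M')
              (Λ'' : Type) [LinearOrder Λ''] [Fintype Λ''] (e'' : Λ'' ≃ ZMod L × ZMod M'')
              (Λ : Type) [LinearOrder Λ] [Fintype Λ] (e : Λ ≃ ZMod L × ZMod M),
              (1 - (M₂ : ℝ) / M) * max (min (tubeStiffness L M' Λ' e' U δ) (tubeStiffness L M'' Λ'' e'' U δ)) 0 ≤
                  tubeStiffness L M Λ e U δ ∧
                (1 - (M₂ : ℝ) / M) *
                    max (min (tubePairCompressibility L M' Λ' e' U δ)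
                      (tubePairCompressibility L M'' Λ'' e'' U δ)) 0 ≤
                  tubePairCompressibility L M Λ e U δ ∧
                tubePairCompressibility L M Λ e U δ ≤
                  (1 + (M₂ : ℝ) / M) *
                    max (max (tubePairCompressibility L M' Λ' e' U δ)
                      (tubePairCompressibility L M'' Λ'' e'' U δ)) 0 :=
  Iff.rfl

/-! ### Free-electron vocabulary of the tube (appended 2026-08-17, session 4 of the `SeamInduction`
prover seat): the plane waves and the free bands of `ℤ/L × ℤ/M`, used by the `U = 0` floor of the
rectangular / twisted tube (`Theorems/WidthHaldaneTubePlaneWaves.lean` and the `Negative/` files of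
`PerWidthThermodynamics`). Definitions only; the diagonalisation is proved in the consumer files. -/

/-- The plane wave (character) of the rectangular torus `ℤ/L × ℤ/M` with momentum `k = (a, b)`:
`χ_k(p, q) = e^{2πi a p/L} e^{2πi b q/M}` (Mathlib's `ZMod.stdAddChar` in each coordinate; the
rectangular analogue of `Literature…torusChar`). [cite: FriedliVelenik2017, §10.4] -/
def tubeChar (L M : ℕ) [NeZero L] [NeZero M] (k p : ZMod L × ZMod M) : ℂ :=
  (ZMod.stdAddChar (k.1 * p.1) : ℂ) * (ZMod.stdAddChar (k.2 * p.2) : ℂ)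

/-- The free band of the rectangular tube: `ε_{L,M}(a, b) = -2cos(2πa/L) - 2cos(2πb/M)`, the
eigenvalue of the `t = 1` hopping matrix of `ℤ/L × ℤ/M` on the plane wave `χ_{(a,b)}`
(`L, M ≥ 3`). [cite: Scalapino1995, §2] -/
def tubeBand (L M : ℕ) (k : ZMod L × ZMod M) : ℝ :=
  -2 * Real.cos (2 * Real.pi * (k.1.val : ℝ) / L) - 2 * Real.cos (2 * Real.pi * (k.2.val : ℝ) / M)

/-- The twisted free band `ε^θ_{L,M}(a, b) = -2cos((2πa - θ)/L) - 2cos(2πb/M)`: the eigenvalue of the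
hopping matrix of the tube with flux `θ` through the long cycle (seam phases `-e^{±iθ}`, i.e.
`tubeH0 + tubeTwist θ` at `U = 0`) on the quasi-periodic plane wave `p ↦ e^{i(2πa-θ)p/L} e^{2πibq/M}`;
as a multiset over `a ∈ ℤ/L` it is the boost-gauge band `-2cos(2πa/L - θ/L) - 2cos(2πb/M)`.
[cite: ScalapinoWhiteZhang1993, §II] -/
def tubeTwistedBand (L M : ℕ) (θ : ℝ) (k : ZMod L × ZMod M) : ℝ :=
  -2 * Real.cos ((2 * Real.pi * (k.1.val : ℝ) - θ) / L) - 2 * Real.cos (2 * Real.pi * (k.2.val : ℝ) / M)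

/-- At zero flux the twisted band is the free band. [folklore] -/
theorem tubeTwistedBand_zero (L M : ℕ) (k : ZMod L × ZMod M) :
    tubeTwistedBand L M 0 k = tubeBand L M k := by
  simp only [tubeTwistedBand, tubeBand, sub_zero]

/-- The plane wave at momentum `0` is the constant `1`. [folklore] -/
theorem tubeChar_zero_left (L M : ℕ) [NeZero L] [NeZero M] (p : ZMod L × ZMod M) :
    tubeChar L M 0 p = 1 := by
  simp [tubeChar]

/-- The plane-wave MODE MATRIX of the labelled tube: the column of the orbital `(z, τ)` is the
normalised plane wave of momentum `e z` carried by spin `τ`,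
`V_{(x,σ),(z,τ)} = δ_{στ} χ_{e z}(e x)/√(LM)` — a spin-diagonal unitary diagonalising the free hopping
matrix of the tube for `L, M ≥ 3` (proved in `WidthHaldaneTubePlaneWaves.lean`). [cite: FriedliVelenik2017, §10.4] -/
def tubePlaneWaves (L M : ℕ) [NeZero L] [NeZero M] (Λ : Type) [LinearOrder Λ] [Fintype Λ]
    (e : Λ ≃ ZMod L × ZMod M) : Matrix (Orb Λ) (Orb Λ) ℂ :=
  Matrix.of fun o o' => if (ofLex o).2 = (ofLex o').2 then
    (((Real.sqrt ((L : ℝ) * M))⁻¹ : ℝ) : ℂ) * tubeChar L M (e (ofLex o').1) (e (ofLex o).1) else 0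

/-- The TWISTED plane-wave mode matrix of the labelled tube with flux `θ` through the long cycle:
the column of `(z, τ)`, `e z = (a, b)`, is the normalised quasi-periodic wave
`(p, q) ↦ e^{i(2πa - θ) p/L} e^{2πi b q/M}/√(LM)` (`p, q` the representatives `ZMod.val`), carried by
spin `τ` — the eigenvectors of the hopping matrix with seam phases `-e^{±iθ}` (`tubeH0 + tubeTwist θ`
at `U = 0`), eigenvalue `tubeTwistedBand L M θ (a, b)`. [cite: ScalapinoWhiteZhang1993, §II] -/
def tubeTwistedPlaneWaves (L M : ℕ) [NeZero L] [NeZero M] (Λ : Type) [LinearOrder Λ] [Fintype Λ]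
    (e : Λ ≃ ZMod L × ZMod M) (θ : ℝ) : Matrix (Orb Λ) (Orb Λ) ℂ :=
  Matrix.of fun o o' => if (ofLex o).2 = (ofLex o').2 then
    (((Real.sqrt ((L : ℝ) * M))⁻¹ : ℝ) : ℂ) *
      (Complex.exp (Complex.I *
          (((2 * Real.pi * ((e (ofLex o').1).1.val : ℝ) - θ) * ((e (ofLex o).1).1.val : ℝ) / L : ℝ) : ℂ)) *
        (ZMod.stdAddChar ((e (ofLex o').1).2 * (e (ofLex o).1).2) : ℂ)) else 0

/-- The mode matrices are spin-diagonal by construction. [folklore] -/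
theorem tubePlaneWaves_apply_of_ne (L M : ℕ) [NeZero L] [NeZero M] (Λ : Type) [LinearOrder Λ]
    [Fintype Λ] (e : Λ ≃ ZMod L × ZMod M) {o o' : Orb Λ} (h : (ofLex o).2 ≠ (ofLex o').2) :
    tubePlaneWaves L M Λ e o o' = 0 := by
  simp only [tubePlaneWaves, Matrix.of_apply, if_neg h]

/-- The twisted mode matrices are spin-diagonal by construction. [folklore] -/
theorem tubeTwistedPlaneWaves_apply_of_ne (L M : ℕ) [NeZero L] [NeZero M] (Λ : Type) [LinearOrder Λ]
    [Fintype Λ] (e : Λ ≃ ZMod L × ZMod M) (θ : ℝ) {o o' : Orb Λ} (h : (ofLex o).2 ≠ (ofLex o').2) :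
    tubeTwistedPlaneWaves L M Λ e θ o o' = 0 := by
  simp only [tubeTwistedPlaneWaves, Matrix.of_apply, if_neg h]

/-! ### The free bands of the two-leg LADDER `ℤ/L × ℤ/2` (appended 2026-08-17, session 7 of the
`SeamInduction` prover seat). At `M = 2` the rung `(a,0) – (a,1)` of `tubeGraph` is a SINGLE bond (the
two transverse steps `±e₂` coincide), so the transverse dispersion of the free tube is `∓1` and not
`-2cos(2πb/2) = ∓2`: the `L, M ≥ 3` band `tubeTwistedBand` does not describe the width everyone
studies first. The ladder band below is diagonalised in `WidthHaldaneLadderPlaneWaves.lean` and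
consumed by `PerWidthThermodynamics/Negative/ZeroCouplingStiffness*.lean`. Definition only. -/

/-- The twisted free band of the isotropic two-leg ladder `ℤ/L × ℤ/2` (`t_⊥ = t = 1`) with flux `θ`
through the long cycle: `ε^θ_{L,2}(a, b) = -2cos((2πa - θ)/L) - (-1)^b` — bonding band `b = 0`
(`-2cos - 1`), antibonding band `b = 1` (`-2cos + 1`); the eigenvalue of `tubeH0 + tubeTwist θ` at
`U = 0`, `M = 2` on the twisted plane wave of momentum `(a, b)` (proved in
`WidthHaldaneLadderPlaneWaves.lean`; at `θ = 0` the free ladder bands of Noack–White–Scalapino).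
[cite: NoackWhiteScalapino1996, §2] -/
def ladderTwistedBand (L : ℕ) (θ : ℝ) (k : ZMod L × ZMod 2) : ℝ :=
  -2 * Real.cos ((2 * Real.pi * (k.1.val : ℝ) - θ) / L) - (-1) ^ k.2.val

end Summit.HubbardSuperconductivity.HubbardSuperconductivity.Theorems.WidthHaldane

end
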